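import Literature.MathematicalPhysics.QuantumFieldTheory.Balaban1983to89.T3CruxEstimates
import Summits.QuantumFields.YangMills.Theses.SmallFieldWidening
import HarnessLib

/-!
# Route `SmallFieldWidening` — crux r2 `AllHeightsSmallTilt` (stmt-QuantumFields-22883) MODULO ITS ONE STUB, in the tree's
# K1 currency (support file; width seat `ym-line-sfw-p2-w3` gen 2 of line `ym-line-sfw-p2`)

The route's crux r2 is the `m = 0` member `UnitTiltAt F γ b₀ p₀ 0` of the tree's K1 body (`T3UnitScaleTilt.UnitTiltAt`; `K / 0 = 0` free
top steps: EVERY block-averaged field of every run, the terminal unit field included, is constrained by Bałaban's threshold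
`θ(K − j)`).  This file lands the measure-theoretic half of the ideator's registered BC3 skeleton
(`Cruxes/AllHeightsSmallTilt/…`, planner `ym-idea-1`: `constrainedLawAC`, `isTilt_of_sandwich`, `AllHeightsSmallTilt_holds_of_stubs`)
AND identifies its one physics stub with the tree's K1 estimate schema at `m = 0`:

* §1 `allHeightsSmallTilt_of_heightSandwichAt` — **r2 ⇐ `T3CruxEstimates.HeightSandwichAt F γ b₀ p₀ 0` under the route prefix**
  (`∀ L (b₀ > 0) (p₀ > 2), ∃ γ₁ > 0, ∀ F (F.L = L) (0 < γ ≤ γ₁)`), by the tree's `unitTiltAt_of_heightSandwichAt` (which carries no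
  `0 < m`): the a.e. two-run sandwich `e^{−r_K}c_K ρ^{(K)}_K ≤ ρ^{(K+1)}_{K+1} ≤ e^{r_K}c_K ρ^{(K)}_K` of the FULLY-CONSTRAINED restricted
  densities READ ON THE UNIT LATTICE (`T3TiltDescent.heightDensity` at `n = 0`), summable radii.
* §2 the constrained unit law of run `K` — `(A_K)_*(Gibbs_K|histGood K 0)` (the skeleton's `claw`) — IS the descended restricted Gibbs
  measure `(D_{0,K})_*(Gibbs_K|histGood K 0)` (`unitA_zero`: `A_0 = id`; `T3TiltDescent.unitA_comp_descendTo`), hence has the density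
  `Z_K⁻¹·heightDensity` with respect to product Haar on the unit lattice (`map_unitA_restrict_eq_withDensity`), is absolutely
  continuous (`map_unitA_restrict_absolutelyContinuous` = the skeleton's `constrainedLawAC`), and its Radon–Nikodym derivative (the
  skeleton's `cud`) is `Z_K⁻¹·heightDensity` a.e. (`rnDeriv_map_unitA_restrict_ae_eq`).
* §3 `isTilt_unitA_of_rnDeriv_sandwich_ae` — an a.e. two-sided sandwich OF THE RADON–NIKODYM DERIVATIVES modulo a constant (the
  registered stub's `ℝ≥0∞` currency) gives the unit-lattice tilt (converted to the real `heightDensity` currency, then the tree's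
  `isTilt_descendTo_of_sandwich_ae` + `isTilt_unitA_of_isTilt_descendTo`).
* §4 `allHeightsSmallTilt_of_smallDataSandwich` — **r2 ⇐ the registered stub `stub_smallDataSandwich` SPELLED OUT** (its `cud`
  unfolded to the Radon–Nikodym derivative of `(A_K)_*(Gibbs_K|histGood K 0)`): the composition of the skeleton, so that the hour the
  stub lands r2 closes by `exact allHeightsSmallTilt_of_smallDataSandwich stub_smallDataSandwich`.

WHAT THIS IS NOT: the sandwich itself (the E3 two-cut-off small-field comparison at the terminal lattice, [King1986] Thm 3.4 (3.9)
shape, [Balaban1985UV3] (41)/(47) one-run envelopes) is NOT proved here — it is the route's open crux r2, booked with route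
`UnitScaleTilt`'s K1 engines; no summit statement is touched (rung R3 record; the Yang–Mills mass gap is not proved by this line).
-/

noncomputable section

open MeasureTheory Filter Topology
open scoped ENNReal
open Literature.MathematicalPhysics.QuantumFieldTheory
open Literature.MathematicalPhysics.QuantumFieldTheory.Balaban1983to89
open Literature.MathematicalPhysics.QuantumFieldTheory.Balaban1983to89.Missing
open Literature.MathematicalPhysics.QuantumFieldTheory.Balaban1983to89.T3ContinuumYM3Torus
open Literature.MathematicalPhysics.QuantumFieldTheory.Balaban1983to89.T3LevelShift
open Literature.MathematicalPhysics.QuantumFieldTheory.Balaban1983to89.T3UnitScaleTilt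
open Literature.MathematicalPhysics.QuantumFieldTheory.Balaban1983to89.T3UnitLawDensityEML
open Literature.MathematicalPhysics.QuantumFieldTheory.Balaban1983to89.T3TiltDescent
open Literature.MathematicalPhysics.QuantumFieldTheory.Balaban1983to89.T3CruxEstimates

namespace Summit.QuantumFields.YangMills.Theorems.AllHeightsSmallTilt

/-! ## §1 r2 ⇐ K1's estimate schema `HeightSandwichAt` at `m = 0` -/

/-- **r2 `AllHeightsSmallTilt` ⇐ THE TREE'S K1 ESTIMATE SCHEMA AT `m = 0` UNDER THE ROUTE PREFIX**: if for every block size `L` and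
profile `(b₀ > 0, p₀ > 2)` there is `γ₁ > 0` such that every three-torus family with `F.L = L` at every coupling `0 < γ ≤ γ₁` satisfies
`HeightSandwichAt F γ b₀ p₀ 0` (a.e. two-run sandwich of the fully-constrained restricted densities read on the unit lattice, summable
radii, free constants), then `AllHeightsSmallTilt` — `T3CruxEstimates.unitTiltAt_of_heightSandwichAt` needs no `0 < m`.
[cite: King1986, Thm 3.4 (3.9) p.656] -/
theorem allHeightsSmallTilt_of_heightSandwichAt
    (h : ∀ (L : ℕ) (b₀ p₀ : ℝ), 0 < b₀ → 2 < p₀ → ∃ γ₁ : ℝ, 0 < γ₁ ∧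
      ∀ (F : T3Family) (γ : ℝ), F.L = L → 0 < γ → γ ≤ γ₁ → HeightSandwichAt F γ b₀ p₀ 0) :
    Summit.QuantumFields.YangMills.Theses.SmallFieldWidening.AllHeightsSmallTilt := by
  intro L b₀ p₀ hb₀ hp₀
  obtain ⟨γ₁, hγ₁, H⟩ := h L b₀ p₀ hb₀ hp₀
  exact ⟨γ₁, hγ₁, fun F γ hFL hγ hle => unitTiltAt_of_heightSandwichAt F hγ.le (H F γ hFL hγ hle)⟩

/-! ## §2 The constrained unit law of run `K` is the descended restricted Gibbs measure at `n = 0`; its density -/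

section UnitLaw

variable (F : T3Family)

/-- **`A_0 = id`**: the unit transport of the `0`-th approximation is the identity (`avg^0 = id`, `unitShift 0 = id`).
[cite: Balaban1987RG1, (0.11) p.253] -/
theorem unitA_zero (U : GaugeField (F.P 0) 0 (Matrix.specialUnitaryGroup (Fin 2) ℂ)) : unitA F ℰp 0 U = U :=
  unitShift_zero F U

/-- **`A_K = D_{0,K}`**: the unit transport of run `K` IS the descent to the `0`-th approximation (`A_K = A_0 ∘ D_{0,K}`, `A_0 = id`).
[cite: Balaban1987RG1, (0.11) p.253] -/
theorem unitA_eq_descendTo_zero (K : ℕ) :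
    (unitA F ℰp K : GaugeField (F.P K) 0 (Matrix.specialUnitaryGroup (Fin 2) ℂ) →
        GaugeField (F.P 0) 0 (Matrix.specialUnitaryGroup (Fin 2) ℂ)) =
      descendTo F ℰp 0 K (Nat.zero_le K) := by
  rw [← unitA_comp_descendTo F ℰp (Nat.zero_le K)]
  funext U
  exact unitA_zero F _

variable {γ : ℝ} (hγ : 0 ≤ γ) (K : ℕ) {S : Set (GaugeField (F.P K) 0 (Matrix.specialUnitaryGroup (Fin 2) ℂ))}

include hγ

/-- **THE CONSTRAINED UNIT LAW HAS THE DENSITY `Z_K⁻¹·ρ^{S}_K`** (the restricted density at the unit height, `heightDensity` at `n = 0`)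
with respect to product Haar on the unit lattice: `(A_K)_*(Gibbs_K|S) = dV.withDensity (Z_K⁻¹·heightDensity)` for every measurable event `S`
(`γ ≥ 0`; tree `map_descendTo_restrict_eq_withDensity` at `n = 0`). [cite: Balaban1985UV3, (2) p.256 and (6) p.257] -/
theorem map_unitA_restrict_eq_withDensity (hS : MeasurableSet S) :
    Measure.map (unitA F ℰp K) ((gibbsK F ℰp γ K).restrict S) =
      (fieldMeasure (F.P 0) 0 (Matrix.specialUnitaryGroup (Fin 2) ℂ)).withDensity (fun V => ENNReal.ofReal
        ((partitionFn (G := Matrix.specialUnitaryGroup (Fin 2) ℂ) (F.P K) ((F.scheme ℰp γ).β K))⁻¹ *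
          heightDensity F γ (Nat.zero_le K) S V)) := by
  rw [unitA_eq_descendTo_zero F K]
  exact map_descendTo_restrict_eq_withDensity F (Nat.zero_le K) hS hγ

/-- **ABSOLUTE CONTINUITY OF THE CONSTRAINED UNIT LAWS** (the skeleton's `constrainedLawAC`, for every measurable event):
`(A_K)_*(Gibbs_K|S) ≪ dV`. [cite: Balaban1985UV3, (2) p.256 and (6) p.257] -/
theorem map_unitA_restrict_absolutelyContinuous (hS : MeasurableSet S) :
    Measure.map (unitA F ℰp K) ((gibbsK F ℰp γ K).restrict S) ≪
      fieldMeasure (F.P 0) 0 (Matrix.specialUnitaryGroup (Fin 2) ℂ) := by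
  rw [map_unitA_restrict_eq_withDensity F hγ K hS]
  exact withDensity_absolutelyContinuous _ _

/-- **THE RADON–NIKODYM DERIVATIVE OF THE CONSTRAINED UNIT LAW** (the skeleton's `cud`) **IS `Z_K⁻¹·ρ^{S}_K` ALMOST EVERYWHERE**.
[cite: Balaban1985UV3, (2) p.256 and (6) p.257] -/
theorem rnDeriv_map_unitA_restrict_ae_eq (hS : MeasurableSet S) :
    (Measure.map (unitA F ℰp K) ((gibbsK F ℰp γ K).restrict S)).rnDeriv
        (fieldMeasure (F.P 0) 0 (Matrix.specialUnitaryGroup (Fin 2) ℂ)) =ᵐ[fieldMeasure (F.P 0) 0 (Matrix.specialUnitaryGroup (Fin 2) ℂ)]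
      fun V => ENNReal.ofReal
        ((partitionFn (G := Matrix.specialUnitaryGroup (Fin 2) ℂ) (F.P K) ((F.scheme ℰp γ).β K))⁻¹ *
          heightDensity F γ (Nat.zero_le K) S V) := by
  haveI : IsProbabilityMeasure (fieldMeasure (F.P 0) 0 (Matrix.specialUnitaryGroup (Fin 2) ℂ)) :=
    Missing.isProbabilityMeasure_fieldMeasure (F.P 0) 0
  rw [map_unitA_restrict_eq_withDensity F hγ K hS]
  exact Measure.rnDeriv_withDensity _ ((heightDensity_props F (Nat.zero_le K) hS hγ).1.const_mul _).ennreal_ofReal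

end UnitLaw

/-! ## §3 From an a.e. sandwich of the Radon–Nikodym derivatives to the unit-lattice tilt -/

section Sandwich

variable (F : T3Family) {γ : ℝ} (hγ : 0 ≤ γ) (K : ℕ)
  {S₀ : Set (GaugeField (F.P K) 0 (Matrix.specialUnitaryGroup (Fin 2) ℂ))}
  {S₁ : Set (GaugeField (F.P (K + 1)) 0 (Matrix.specialUnitaryGroup (Fin 2) ℂ))}

include hγ

/-- **THE UNIT-LATTICE TILT ⇐ AN A.E. SANDWICH OF THE RADON–NIKODYM DERIVATIVES MODULO A CONSTANT** (`ℝ≥0∞` currency of the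
registered stub): if `ofReal(c·e^{−r})·ϱ_K ≤ ϱ_{K+1} ≤ ofReal(c·e^{r})·ϱ_K` a.e. for the Radon–Nikodym derivatives `ϱ` of the two
runs' constrained unit laws (events `S₀`, `S₁` measurable; `r ≥ 0`, `c > 0`), then `(A_{K+1})_*(Gibbs_{K+1}|S₁)` is a tilt of radius `r`
of `(A_K)_*(Gibbs_K|S₀)`.  Proof: `ϱ = Z⁻¹·heightDensity` a.e. (§2), so the sandwich is the tree's real `heightDensity` sandwich at
`n = 0` with the constant `c·Z_{K+1}/Z_K`; then `isTilt_descendTo_of_sandwich_ae` and `isTilt_unitA_of_isTilt_descendTo`.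
[cite: King1986, Thm 3.4 (3.9) p.656] -/
theorem isTilt_unitA_of_rnDeriv_sandwich_ae (hS₀ : MeasurableSet S₀) (hS₁ : MeasurableSet S₁) {r c : ℝ} (hr : 0 ≤ r)
    (hc : 0 < c)
    (hsw : ∀ᵐ V ∂fieldMeasure (F.P 0) 0 (Matrix.specialUnitaryGroup (Fin 2) ℂ),
      ENNReal.ofReal (c * Real.exp (-r)) *
            (Measure.map (unitA F ℰp K) ((gibbsK F ℰp γ K).restrict S₀)).rnDeriv
              (fieldMeasure (F.P 0) 0 (Matrix.specialUnitaryGroup (Fin 2) ℂ)) V ≤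
          (Measure.map (unitA F ℰp (K + 1)) ((gibbsK F ℰp γ (K + 1)).restrict S₁)).rnDeriv
            (fieldMeasure (F.P 0) 0 (Matrix.specialUnitaryGroup (Fin 2) ℂ)) V ∧
        (Measure.map (unitA F ℰp (K + 1)) ((gibbsK F ℰp γ (K + 1)).restrict S₁)).rnDeriv
            (fieldMeasure (F.P 0) 0 (Matrix.specialUnitaryGroup (Fin 2) ℂ)) V ≤
          ENNReal.ofReal (c * Real.exp r) *
            (Measure.map (unitA F ℰp K) ((gibbsK F ℰp γ K).restrict S₀)).rnDeriv
              (fieldMeasure (F.P 0) 0 (Matrix.specialUnitaryGroup (Fin 2) ℂ)) V) :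
    IsTilt (Measure.map (unitA F ℰp K) ((gibbsK F ℰp γ K).restrict S₀))
      (Measure.map (unitA F ℰp (K + 1)) ((gibbsK F ℰp γ (K + 1)).restrict S₁)) r := by
  -- the partition functions
  set Z₀ : ℝ := partitionFn (G := Matrix.specialUnitaryGroup (Fin 2) ℂ) (F.P K) ((F.scheme ℰp γ).β K) with hZ₀
  set Z₁ : ℝ := partitionFn (G := Matrix.specialUnitaryGroup (Fin 2) ℂ) (F.P (K + 1)) ((F.scheme ℰp γ).β (K + 1))
    with hZ₁
  have hZ₀p : 0 < Z₀ := partitionFn_pos' _ (F.scheme_β_nonneg ℰp hγ K)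
  have hZ₁p : 0 < Z₁ := partitionFn_pos' _ (F.scheme_β_nonneg ℰp hγ (K + 1))
  -- the two densities at the unit height
  set ρ₀ : GaugeField (F.P 0) 0 (Matrix.specialUnitaryGroup (Fin 2) ℂ) → ℝ := heightDensity F γ (Nat.zero_le K) S₀ with hρ₀
  set ρ₁ : GaugeField (F.P 0) 0 (Matrix.specialUnitaryGroup (Fin 2) ℂ) → ℝ :=
    heightDensity F γ ((Nat.zero_le K).trans (Nat.le_succ K)) S₁ with hρ₁
  have hρ₀0 : ∀ V, 0 ≤ ρ₀ V := fun V => heightDensity_nonneg F γ _ S₀ V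
  have hρ₁0 : ∀ V, 0 ≤ ρ₁ V := fun V => heightDensity_nonneg F γ _ S₁ V
  -- the real sandwich of the `heightDensity`s with the constant `c·Z₁/Z₀`
  have hreal : ∀ᵐ V ∂fieldMeasure (F.P 0) 0 (Matrix.specialUnitaryGroup (Fin 2) ℂ),
      Real.exp (-r) * (c * Z₁ / Z₀) * ρ₀ V ≤ ρ₁ V ∧ ρ₁ V ≤ Real.exp r * (c * Z₁ / Z₀) * ρ₀ V := by
    filter_upwards [hsw, rnDeriv_map_unitA_restrict_ae_eq F hγ K hS₀,
      rnDeriv_map_unitA_restrict_ae_eq F hγ (K + 1) hS₁] with V hV h₀ h₁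
    rw [h₀, h₁] at hV
    obtain ⟨hlo, hhi⟩ := hV
    have hce : 0 ≤ c * Real.exp (-r) := mul_nonneg hc.le (Real.exp_pos _).le
    have hce' : 0 ≤ c * Real.exp r := mul_nonneg hc.le (Real.exp_pos _).le
    have ha0 : 0 ≤ Z₀⁻¹ * ρ₀ V := mul_nonneg (inv_nonneg.mpr hZ₀p.le) (hρ₀0 V)
    have ha1 : 0 ≤ Z₁⁻¹ * ρ₁ V := mul_nonneg (inv_nonneg.mpr hZ₁p.le) (hρ₁0 V)
    have hlo' : c * Real.exp (-r) * (Z₀⁻¹ * ρ₀ V) ≤ Z₁⁻¹ * ρ₁ V := by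
      rw [← ENNReal.ofReal_mul hce] at hlo
      exact (ENNReal.ofReal_le_ofReal_iff ha1).mp hlo
    have hhi' : Z₁⁻¹ * ρ₁ V ≤ c * Real.exp r * (Z₀⁻¹ * ρ₀ V) := by
      rw [← ENNReal.ofReal_mul hce'] at hhi
      exact (ENNReal.ofReal_le_ofReal_iff (mul_nonneg hce' ha0)).mp hhi
    have hZ₀ne : Z₀ ≠ 0 := hZ₀p.ne'
    have hZ₁ne : Z₁ ≠ 0 := hZ₁p.ne'
    constructor
    · -- multiply the lower bound by `Z₁ > 0`
      have e1 : Real.exp (-r) * (c * Z₁ / Z₀) * ρ₀ V = Z₁ * (c * Real.exp (-r) * (Z₀⁻¹ * ρ₀ V)) := by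
        field_simp
      have e2 : ρ₁ V = Z₁ * (Z₁⁻¹ * ρ₁ V) := by field_simp
      rw [e1, e2]
      exact mul_le_mul_of_nonneg_left hlo' hZ₁p.le
    · have e1 : Real.exp r * (c * Z₁ / Z₀) * ρ₀ V = Z₁ * (c * Real.exp r * (Z₀⁻¹ * ρ₀ V)) := by
        field_simp
      have e2 : ρ₁ V = Z₁ * (Z₁⁻¹ * ρ₁ V) := by field_simp
      rw [e1, e2]
      exact mul_le_mul_of_nonneg_left hhi' hZ₁p.le
  -- the descended tilt at `n = 0`, then the unit-lattice tilt
  have hdesc := isTilt_descendTo_of_sandwich_ae F hγ (Nat.zero_le K) hS₀ hS₁ hr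
    (div_pos (mul_pos hc hZ₁p) hZ₀p) hreal
  exact isTilt_unitA_of_isTilt_descendTo F ℰp measurableE_ℰp hγ (Nat.zero_le K) S₀ S₁ hdesc

end Sandwich

/-! ## §4 r2 ⇐ the registered stub `stub_smallDataSandwich`, spelled out -/

/-- **r2 `AllHeightsSmallTilt` ⇐ THE REGISTERED STUB `stub_smallDataSandwich` OF THE BC3 SKELETON** (its text verbatim with the
skeleton's `cud F γ b₀ p₀ K` = the Radon–Nikodym derivative of `(A_K)_*(Gibbs_K|histGood K 0)` with respect to product Haar on the unit
lattice, and `SU2 = Matrix.specialUnitaryGroup (Fin 2) ℂ`, unfolded): for every `L` and profile `(b₀ > 0, p₀ > 2)` a threshold `γ₁ > 0`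
such that for every family with `F.L = L` at `0 < γ ≤ γ₁` there are summable radii `r_K ≥ 0` and, for every `K`, a constant `c_K > 0`
with the a.e. sandwich `ofReal(c_K e^{−r_K})·ϱ_K ≤ ϱ_{K+1} ≤ ofReal(c_K e^{r_K})·ϱ_K` ⇒ `AllHeightsSmallTilt` (§3 at the all-heights
small-field events, `K / 0 = 0`). [cite: King1986, Thm 3.4 (3.9) p.656] -/
theorem allHeightsSmallTilt_of_smallDataSandwich
    (h : ∀ (L : ℕ) (b₀ p₀ : ℝ), 0 < b₀ → 2 < p₀ → ∃ γ₁ : ℝ, 0 < γ₁ ∧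
      ∀ (F : T3Family) (γ : ℝ), F.L = L → 0 < γ → γ ≤ γ₁ → ∃ r : ℕ → ℝ, Summable r ∧ (∀ K, 0 ≤ r K) ∧
        ∀ K : ℕ, ∃ c : ℝ, 0 < c ∧ ∀ᵐ V ∂(fieldMeasure (F.P 0) 0 (Matrix.specialUnitaryGroup (Fin 2) ℂ)),
          ENNReal.ofReal (c * Real.exp (-(r K))) *
                (Measure.map (unitA F ℰp K)
                    ((gibbsK F ℰp γ K).restrict (histGood F ℰp (θBal F.L γ b₀ p₀) K 0))).rnDeriv
                  (fieldMeasure (F.P 0) 0 (Matrix.specialUnitaryGroup (Fin 2) ℂ)) V ≤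
              (Measure.map (unitA F ℰp (K + 1))
                  ((gibbsK F ℰp γ (K + 1)).restrict (histGood F ℰp (θBal F.L γ b₀ p₀) (K + 1) 0))).rnDeriv
                (fieldMeasure (F.P 0) 0 (Matrix.specialUnitaryGroup (Fin 2) ℂ)) V ∧
            (Measure.map (unitA F ℰp (K + 1))
                  ((gibbsK F ℰp γ (K + 1)).restrict (histGood F ℰp (θBal F.L γ b₀ p₀) (K + 1) 0))).rnDeriv
                (fieldMeasure (F.P 0) 0 (Matrix.specialUnitaryGroup (Fin 2) ℂ)) V ≤
              ENNReal.ofReal (c * Real.exp (r K)) *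
                (Measure.map (unitA F ℰp K)
                    ((gibbsK F ℰp γ K).restrict (histGood F ℰp (θBal F.L γ b₀ p₀) K 0))).rnDeriv
                  (fieldMeasure (F.P 0) 0 (Matrix.specialUnitaryGroup (Fin 2) ℂ)) V) :
    Summit.QuantumFields.YangMills.Theses.SmallFieldWidening.AllHeightsSmallTilt := by
  intro L b₀ p₀ hb₀ hp₀
  obtain ⟨γ₁, hγ₁, H⟩ := h L b₀ p₀ hb₀ hp₀
  refine ⟨γ₁, hγ₁, fun F γ hFL hγ hle => ?_⟩
  obtain ⟨r, hr, hr0, hS⟩ := H F γ hFL hγ hle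
  refine ⟨r, hr, fun K => ?_⟩
  obtain ⟨c, hc, hsw⟩ := hS K
  have ht := isTilt_unitA_of_rnDeriv_sandwich_ae F hγ.le K
    (measurableSet_histGood F ℰp measurableE_ℰp (θBal F.L γ b₀ p₀) K 0)
    (measurableSet_histGood F ℰp measurableE_ℰp (θBal F.L γ b₀ p₀) (K + 1) 0) (hr0 K) hc hsw
  simpa only [Nat.div_zero] using ht

end Summit.QuantumFields.YangMills.Theorems.AllHeightsSmallTilt

end
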